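import Summits.NavierStokesRegularity.NavierStokesRegularity.Theorems.ArgmaxDoorsDefs
import Summits.NavierStokesRegularity.NavierStokesRegularity.Theorems.ArgmaxDoorsDepletionIntegrand
import Mathlib.MeasureTheory.Measure.Lebesgue.VolumeOfBalls
import HarnessLib

/-!
# ArgmaxDoorsDepletionBounds — door family S35 «ArgmaxDoors»: the depletion integral made checkable

S-door lane tools (ns-sfl-p1 g5; texts of record nsreg-p1 g29 ROUND-33 `r33/Sketch35.lean` v3 sha16
93168f45ce53c5c4 = tree P0 `Theorems/ArgmaxDoorsDefs.lean` p645080; `--supports stmt-NavierStokesRegularity-0056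
--as helper`). Door S35-C «ArgmaxCoherenceDoor» asks, at a vorticity argmax `x̄`, for a bound on the DEPLETION
INTEGRAL `∫ |ω(y) − ⟪ω(y), ξ(x̄)⟫ξ(x̄)| |x̄ − y|⁻³ dy` (`depletionIntegral`, P0). This file bounds it by two
checkable quantities:

* `integral_sq_farCube` — `∫ (1_{|x̄−y| ≥ r}|x̄ − y|⁻³)² dy = 4π/(3r³)`;
* `integral_norm_mul_farCube_le` — the FAR TAIL by the enstrophy:
  `∫_{|x̄−y| ≥ r} ‖ω(y)‖ |x̄ − y|⁻³ dy ≤ (4π/(3r³))^{1/2} ‖ω‖_{L²}` (Cauchy–Schwarz);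
* `integral_depletion_le_of_localCoherence` — under LOCAL COHERENCE AT THE POINT,
  `‖ω(y) − ⟪ω(y), e⟫e‖ ≤ Λ|y − x̄|` on `B(x̄, r)` (`= |ω(y)|·sin∠(ω(y), e) ≤ Λ|y − x̄|`: Constantin–Fefferman's
  Lipschitz-direction hypothesis read from one point, with `Λ = sup|ω|/ρ`), the whole integral is
  `≤ 4π r Λ + (4π/(3r³))^{1/2} ‖ω‖_{L²}` (`integral_kernelMajorant`: `∫_{|z|<r}|z|⁻² = 4πr`);
* `depletionIntegral_le_of_localCoherence` — the same in the frame's vocabulary (`depletionIntegral u t x̄`,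
  `e = vorticityDirection (curl (u t)) x̄`).

WHAT THIS IS NOT: quantitative tools for a regularity CRITERION (door S35-C) about hypothetical blow-up; item
0056 `NoTypeII` and NS regularity are NOT proved; nothing here is a route or a summit statement.
-/

-- the summit's problem namespace repeats the summit name (tree layout)
set_option linter.dupNamespace false

noncomputable section

open MeasureTheory Set Function Filter Metric Real InnerProductSpace
open scoped ENNReal NNReal RealInnerProductSpace Topology

namespace Summit.NavierStokesRegularity.NavierStokesRegularity.Theorems.ArgmaxDoors

open Literature.Analysis.FluidPDE

/-! ### The far kernel squared integrates to `4π/(3r³)` -/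

/-- `∫ (1_{|x₀−y| ≥ r} |x₀ − y|⁻³)² dy = 4π/(3r³)` for `r > 0`
(`NewtonPotentialHolder.integral_compl_ball_norm_rpow_neg` with `t = 6`, `|B₁| = 4π/3`). -/
theorem integral_sq_farCube {r : ℝ} (hr : 0 < r) (x₀ : EuclideanSpace ℝ (Fin 3)) :
    ∫ y, ((ball (0 : EuclideanSpace ℝ (Fin 3)) r)ᶜ.indicator (fun z => (‖z‖ ^ 3)⁻¹) (x₀ - y)) ^ 2 =
      4 * π / (3 * r ^ 3) := by
  rw [integral_sub_left_eq_self
    (fun z => ((ball (0 : EuclideanSpace ℝ (Fin 3)) r)ᶜ.indicator (fun z => (‖z‖ ^ 3)⁻¹) z) ^ 2) volume x₀]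
  have heq : (fun z : EuclideanSpace ℝ (Fin 3) =>
      ((ball (0 : EuclideanSpace ℝ (Fin 3)) r)ᶜ.indicator (fun z => (‖z‖ ^ 3)⁻¹) z) ^ 2) =
      (ball (0 : EuclideanSpace ℝ (Fin 3)) r)ᶜ.indicator fun z => ‖z‖ ^ (-(6 : ℝ)) := by
    funext z
    by_cases hz : z ∈ (ball (0 : EuclideanSpace ℝ (Fin 3)) r)ᶜ
    · have hzpos : 0 < ‖z‖ := by
        rw [mem_compl_iff, mem_ball_zero_iff, not_lt] at hz
        exact hr.trans_le hz
      rw [indicator_of_mem hz, indicator_of_mem hz, Real.rpow_neg hzpos.le, ← inv_pow, ← pow_mul,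
        ← Real.rpow_natCast, inv_rpow hzpos.le]
      norm_num
    · rw [indicator_of_notMem hz, indicator_of_notMem hz, zero_pow two_ne_zero]
  rw [heq, integral_indicator measurableSet_ball.compl,
    NewtonPotentialHolder.integral_compl_ball_norm_rpow_neg (by norm_num : (3 : ℝ) < 6) hr,
    measureReal_def, EuclideanSpace.volume_ball_fin_three, ENNReal.toReal_mul, ← ENNReal.ofReal_pow zero_le_one,
    one_pow, ENNReal.toReal_ofReal zero_le_one, ENNReal.toReal_ofReal (by positivity : (0 : ℝ) ≤ π * 4 / 3)]
  have h36 : r ^ ((3 : ℝ) - 6) = (r ^ 3)⁻¹ := by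
    rw [show ((3 : ℝ) - 6) = -(3 : ℝ) by norm_num, Real.rpow_neg hr.le, ← Real.rpow_natCast]
    norm_num
  rw [h36]
  field_simp
  ring

/-! ### The far tail by the enstrophy -/

/-- **Far tail of the depletion integral**: for continuous `ω` with `∫‖ω‖² < ∞` and `r > 0`,
`∫_{|x₀−y| ≥ r} ‖ω(y)‖ |x₀ − y|⁻³ dy ≤ (4π/(3r³))^{1/2} · (∫‖ω‖²)^{1/2}` (Cauchy–Schwarz). -/
theorem integral_norm_mul_farCube_le {w : EuclideanSpace ℝ (Fin 3) → EuclideanSpace ℝ (Fin 3)}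
    (hwc : Continuous w) (hw2 : Integrable fun y => ‖w y‖ ^ 2) (x₀ : EuclideanSpace ℝ (Fin 3))
    {r : ℝ} (hr : 0 < r) :
    ∫ y, ‖w y‖ * (ball (0 : EuclideanSpace ℝ (Fin 3)) r)ᶜ.indicator (fun z => (‖z‖ ^ 3)⁻¹) (x₀ - y) ≤
      (4 * π / (3 * r ^ 3)) ^ (1 / (2 : ℝ)) * (∫ y, ‖w y‖ ^ 2) ^ (1 / (2 : ℝ)) := by
  have h2 : ENNReal.ofReal 2 = (2 : ℝ≥0∞) := by norm_num
  have hk0 : ∀ z, 0 ≤ (ball (0 : EuclideanSpace ℝ (Fin 3)) r)ᶜ.indicator (fun z => (‖z‖ ^ 3)⁻¹) z :=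
    farKernel_nonneg 3 r
  have hkm : AEStronglyMeasurable
      (fun z => (ball (0 : EuclideanSpace ℝ (Fin 3)) r)ᶜ.indicator (fun z => (‖z‖ ^ 3)⁻¹) z) volume :=
    (((measurable_norm.pow_const 3).inv).indicator measurableSet_ball.compl).aestronglyMeasurable
  have hk : MemLp (fun z => (ball (0 : EuclideanSpace ℝ (Fin 3)) r)ᶜ.indicator (fun z => (‖z‖ ^ 3)⁻¹) z)
      (ENNReal.ofReal 2) volume := by
    rw [h2, memLp_two_iff_integrable_sq hkm]
    have h := integrable_sq_farKernel (by norm_num : 2 ≤ 3) hr (0 : EuclideanSpace ℝ (Fin 3))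
    refine h.congr (Eventually.of_forall fun z => ?_)
    simp only [zero_sub, sq]
    rw [show (ball (0 : EuclideanSpace ℝ (Fin 3)) r)ᶜ.indicator (fun z => (‖z‖ ^ 3)⁻¹) (-z) =
      (ball (0 : EuclideanSpace ℝ (Fin 3)) r)ᶜ.indicator (fun z => (‖z‖ ^ 3)⁻¹) z by
        by_cases hz : z ∈ (ball (0 : EuclideanSpace ℝ (Fin 3)) r)ᶜ
        · have hz' : -z ∈ (ball (0 : EuclideanSpace ℝ (Fin 3)) r)ᶜ := by
            simpa [mem_compl_iff, mem_ball_zero_iff, norm_neg] using hz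
          rw [indicator_of_mem hz, indicator_of_mem hz', norm_neg]
        · have hz' : -z ∉ (ball (0 : EuclideanSpace ℝ (Fin 3)) r)ᶜ := by
            simpa [mem_compl_iff, mem_ball_zero_iff, norm_neg] using hz
          rw [indicator_of_notMem hz, indicator_of_notMem hz']]
  have hg : MemLp (fun y => ‖w y‖) (ENNReal.ofReal 2) volume := by
    rw [h2, memLp_two_iff_integrable_sq hwc.norm.aestronglyMeasurable]
    exact hw2
  have h := integral_mul_comp_sub_le_L2 hk0 (fun y => norm_nonneg (w y)) hk hg x₀
  have hcomm : ∫ y, ‖w y‖ * (ball (0 : EuclideanSpace ℝ (Fin 3)) r)ᶜ.indicator (fun z => (‖z‖ ^ 3)⁻¹) (x₀ - y)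
      = ∫ y, (ball (0 : EuclideanSpace ℝ (Fin 3)) r)ᶜ.indicator (fun z => (‖z‖ ^ 3)⁻¹) (x₀ - y) * ‖w y‖ :=
    integral_congr_ae (Eventually.of_forall fun y => mul_comm _ _)
  rw [hcomm]
  refine h.trans (le_of_eq ?_)
  congr 1
  · congr 1
    rw [← integral_sq_farCube hr (0 : EuclideanSpace ℝ (Fin 3)),
      ← integral_sub_left_eq_self (fun z => ((ball (0 : EuclideanSpace ℝ (Fin 3)) r)ᶜ.indicator
        (fun z => (‖z‖ ^ 3)⁻¹) z) ^ (2 : ℝ)) volume (0 : EuclideanSpace ℝ (Fin 3))]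
    refine integral_congr_ae (Eventually.of_forall fun y => ?_)
    simp only [Real.rpow_two]
  · congr 1
    refine integral_congr_ae (Eventually.of_forall fun y => ?_)
    simp only [Real.rpow_two]

/-! ### The whole integral under local coherence at the point -/

/-- **The depletion integral under local coherence.** Let `ω` be continuous with `∫‖ω‖² < ∞`, `‖e‖ ≤ 1`,
`r > 0`, `Λ ≥ 0`, and suppose LOCAL COHERENCE at `x₀`: `‖ω(y) − ⟪ω(y), e⟫e‖ ≤ Λ|y − x₀|` for `|y − x₀| < r`.
Then `∫ ‖ω(y) − ⟪ω(y), e⟫e‖ |x₀ − y|⁻³ dy ≤ 4π r Λ + (4π/(3r³))^{1/2} (∫‖ω‖²)^{1/2}`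
(near: `≤ Λ|x₀ − y|⁻²`, `∫_{|z|<r}|z|⁻² = 4πr`; far: the tail lemma, `‖ω − ⟪ω,e⟫e‖ ≤ ‖ω‖`). -/
theorem integral_depletion_le_of_localCoherence {w : EuclideanSpace ℝ (Fin 3) → EuclideanSpace ℝ (Fin 3)}
    (hwc : Continuous w) (hw2 : Integrable fun y => ‖w y‖ ^ 2) {x₀ e : EuclideanSpace ℝ (Fin 3)}
    (he : ‖e‖ ≤ 1) {r Λ : ℝ} (hr : 0 < r) (hΛ : 0 ≤ Λ)
    (hcoh : ∀ y, ‖y - x₀‖ < r → ‖w y - ⟪w y, e⟫ • e‖ ≤ Λ * ‖y - x₀‖) :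
    ∫ y, ‖w y - ⟪w y, e⟫ • e‖ * (‖x₀ - y‖ ^ 3)⁻¹ ≤
      4 * π * r * Λ + (4 * π / (3 * r ^ 3)) ^ (1 / (2 : ℝ)) * (∫ y, ‖w y‖ ^ 2) ^ (1 / (2 : ℝ)) := by
  -- the majorant `Λ 1_{<r}|x₀−y|⁻² + ‖ω y‖ 1_{≥r}|x₀−y|⁻³`
  have hmaj : ∀ y, ‖w y - ⟪w y, e⟫ • e‖ * (‖x₀ - y‖ ^ 3)⁻¹ ≤
      Λ * kernelMajorant r (x₀ - y) +
        ‖w y‖ * (ball (0 : EuclideanSpace ℝ (Fin 3)) r)ᶜ.indicator (fun z => (‖z‖ ^ 3)⁻¹) (x₀ - y) := by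
    intro y
    have hfar0 : 0 ≤ ‖w y‖ *
        (ball (0 : EuclideanSpace ℝ (Fin 3)) r)ᶜ.indicator (fun z => (‖z‖ ^ 3)⁻¹) (x₀ - y) :=
      mul_nonneg (norm_nonneg _) (farKernel_nonneg 3 r _)
    have hnear0 : 0 ≤ Λ * kernelMajorant r (x₀ - y) := mul_nonneg hΛ (kernelMajorant_nonneg _ _)
    by_cases hy : ‖x₀ - y‖ < r
    · by_cases hyx : y = x₀
      · subst hyx
        rw [sub_self] at hnear0 hfar0 ⊢
        rw [norm_zero, zero_pow three_ne_zero, inv_zero, mul_zero]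
        exact add_nonneg hnear0 hfar0
      · have hpos : 0 < ‖x₀ - y‖ := norm_pos_iff.2 (sub_ne_zero.2 (Ne.symm hyx))
        have hmem : x₀ - y ∈ ball (0 : EuclideanSpace ℝ (Fin 3)) r := by rwa [mem_ball_zero_iff]
        have hk : kernelMajorant r (x₀ - y) = (‖x₀ - y‖ ^ 2)⁻¹ := by
          rw [kernelMajorant, indicator_of_mem hmem]
        have h1 : ‖w y - ⟪w y, e⟫ • e‖ ≤ Λ * ‖x₀ - y‖ := by
          rw [norm_sub_rev x₀ y]; exact hcoh y (by rw [norm_sub_rev]; exact hy)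
        calc ‖w y - ⟪w y, e⟫ • e‖ * (‖x₀ - y‖ ^ 3)⁻¹ ≤ (Λ * ‖x₀ - y‖) * (‖x₀ - y‖ ^ 3)⁻¹ :=
              mul_le_mul_of_nonneg_right h1 (by positivity)
          _ = Λ * kernelMajorant r (x₀ - y) := by rw [hk]; field_simp
          _ ≤ _ := le_add_of_nonneg_right hfar0
    · rw [not_lt] at hy
      have hk : (ball (0 : EuclideanSpace ℝ (Fin 3)) r)ᶜ.indicator (fun z => (‖z‖ ^ 3)⁻¹) (x₀ - y) =
          (‖x₀ - y‖ ^ 3)⁻¹ := farKernel_eq_of_le hy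
      calc ‖w y - ⟪w y, e⟫ • e‖ * (‖x₀ - y‖ ^ 3)⁻¹ ≤ ‖w y‖ * (‖x₀ - y‖ ^ 3)⁻¹ :=
            mul_le_mul_of_nonneg_right (norm_sub_inner_smul_le he _) (by positivity)
        _ = ‖w y‖ * (ball (0 : EuclideanSpace ℝ (Fin 3)) r)ᶜ.indicator (fun z => (‖z‖ ^ 3)⁻¹) (x₀ - y) := by
            rw [hk]
        _ ≤ _ := le_add_of_nonneg_left hnear0
  -- integrability of the two pieces
  have hnearI : Integrable fun y => Λ * kernelMajorant r (x₀ - y) :=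
    ((integrable_kernelMajorant r).comp_sub_left x₀).const_mul Λ
  have hfarI := integrable_norm_mul_farCube hwc hw2 x₀ hr
  have hmeas : AEStronglyMeasurable (fun y => ‖w y - ⟪w y, e⟫ • e‖ * (‖x₀ - y‖ ^ 3)⁻¹) volume := by
    have hci : Continuous fun y => ⟪w y, e⟫ := Continuous.inner (𝕜 := ℝ) hwc continuous_const
    have hc1 : Continuous fun y => ‖w y - ⟪w y, e⟫ • e‖ := (hwc.sub (hci.smul continuous_const)).norm
    have hc2 : Continuous fun y : EuclideanSpace ℝ (Fin 3) => ‖x₀ - y‖ ^ 3 :=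
      (continuous_const.sub continuous_id).norm.pow 3
    exact (hc1.measurable.mul hc2.measurable.inv).aestronglyMeasurable
  have hGI : Integrable fun y => ‖w y - ⟪w y, e⟫ • e‖ * (‖x₀ - y‖ ^ 3)⁻¹ := by
    refine (hnearI.add hfarI).mono' hmeas (Eventually.of_forall fun y => ?_)
    rw [Real.norm_of_nonneg (by positivity)]
    exact hmaj y
  -- integrate
  have hnear : ∫ y, Λ * kernelMajorant r (x₀ - y) = 4 * π * r * Λ := by
    rw [integral_const_mul, integral_sub_left_eq_self (kernelMajorant r) volume x₀,
      integral_kernelMajorant hr.le]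
    ring
  calc ∫ y, ‖w y - ⟪w y, e⟫ • e‖ * (‖x₀ - y‖ ^ 3)⁻¹
      ≤ ∫ y, (Λ * kernelMajorant r (x₀ - y) +
          ‖w y‖ * (ball (0 : EuclideanSpace ℝ (Fin 3)) r)ᶜ.indicator (fun z => (‖z‖ ^ 3)⁻¹) (x₀ - y)) :=
        integral_mono hGI (hnearI.add hfarI) hmaj
    _ = 4 * π * r * Λ + ∫ y, ‖w y‖ *
          (ball (0 : EuclideanSpace ℝ (Fin 3)) r)ᶜ.indicator (fun z => (‖z‖ ^ 3)⁻¹) (x₀ - y) := by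
        rw [integral_add hnearI hfarI, hnear]
    _ ≤ 4 * π * r * Λ + (4 * π / (3 * r ^ 3)) ^ (1 / (2 : ℝ)) * (∫ y, ‖w y‖ ^ 2) ^ (1 / (2 : ℝ)) := by
        gcongr
        exact integral_norm_mul_farCube_le hwc hw2 x₀ hr

/-- **The depletion integral of the frame under local coherence at the point** (P0 vocabulary): for a slice with
continuous square-integrable vorticity, `r > 0`, `Λ ≥ 0`, if
`‖ω(y) − ⟪ω(y), ξ(x̄)⟫ξ(x̄)‖ ≤ Λ|y − x̄|` for `|y − x̄| < r` (`ξ(x̄) = vorticityDirection (curl (u t)) x̄`), then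
`depletionIntegral u t x̄ ≤ 4π r Λ + (4π/(3r³))^{1/2} (∫‖curl (u t)‖²)^{1/2}`. With `Λ = ‖ω(t)‖_∞/ρ` this is
Constantin–Fefferman's Lipschitz-direction hypothesis SEEN FROM THE ARGMAX; door S35-C then asks
`(T − t)·A·(4π r ‖ω‖_∞/ρ + (4π/(3r³))^{1/2}‖ω‖₂) ≤ a + (T − t)ν|∇ξ(x̄)|²_F` for some `r = r(t)`. -/
theorem depletionIntegral_le_of_localCoherence
    (u : ℝ → (EuclideanSpace ℝ (Fin 3)) → (EuclideanSpace ℝ (Fin 3))) (t : ℝ)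
    {x : EuclideanSpace ℝ (Fin 3)} (hωc : Continuous (curl (u t)))
    (hω2 : Integrable fun y => ‖curl (u t) y‖ ^ 2) {r Λ : ℝ} (hr : 0 < r) (hΛ : 0 ≤ Λ)
    (hcoh : ∀ y, ‖y - x‖ < r → ‖curl (u t) y - ⟪curl (u t) y, vorticityDirection (curl (u t)) x⟫ •
      vorticityDirection (curl (u t)) x‖ ≤ Λ * ‖y - x‖) :
    depletionIntegral u t x ≤
      4 * π * r * Λ + (4 * π / (3 * r ^ 3)) ^ (1 / (2 : ℝ)) * (∫ y, ‖curl (u t) y‖ ^ 2) ^ (1 / (2 : ℝ)) := by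
  have he : ‖vorticityDirection (curl (u t)) x‖ ≤ 1 := by
    by_cases hx : curl (u t) x = 0
    · rw [(vorticityDirection_eq_zero_iff _ x).2 hx, norm_zero]; exact zero_le_one
    · exact (norm_vorticityDirection _ hx).le
  unfold depletionIntegral
  exact integral_depletion_le_of_localCoherence hωc hω2 he hr hΛ hcoh

end Summit.NavierStokesRegularity.NavierStokesRegularity.Theorems.ArgmaxDoors

end
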